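import Mathlib
import Literature.Combinatorics.SimpleGraph.LovaszThetaDual
import Literature.Combinatorics.SimpleGraph.LovaszThetaComplement
import Literature.Combinatorics.SimpleGraph.HoffmanLovaszBound
import HarnessLib

/-!
# Lovász 1979, Theorem 9 (equality case): `ϑ(G) = nτ/(k+τ)` for edge-transitive regular graphs

Literature anchor (engines group, SDP-3 idle lane; shared numerical engines serving client
cells — rigour lives in the verifiers; every published number belongs to a client cell's
ledger, not to the engines group).

Lovász (1979, Theorem 9, p. 5): "Let `G` be a regular graph, and let `λ₁ ≥ λ₂ ≥ … ≥ λ_n` be the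
eigenvalues of its adjacency matrix `A`. Then `ϑ(G) ≤ -nλ_n/(λ₁ - λ_n)`. Equality holds if the
automorphism group of `G` is transitive on the edges."  The inequality is the tree's
`HoffmanLovaszBound.lovaszTheta_le_ratioBound` (`ϑ(G) ≤ nτ/(k+τ)` for `k`-regular `G` with
`A + τI ⪰ 0`, `τ > 0`).  This file proves the **equality half**, following Lovász's proof (p. 5)
as retold by Knuth (1994, §25, Lemma: "If `G` is edge-symmetric and regular, equality holds in
Lemma 24"):

1. (*symmetrisation of an optimum dual matrix*) by `exists_dual_of_lovaszTheta_eq` there is a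
   Knuth-feasible `C` (`c_{ij} = 1` for `i = j` or `i, j` non-adjacent) with `ϑ(G) I - C ⪰ 0`;
   its average `C̄ = |Γ|⁻¹ Σ_{P ∈ Γ} P⁻¹ C P` over the automorphism group `Γ` is again feasible with
   `ϑ I - C̄ ⪰ 0`, and is `Γ`-invariant (`exists_dual_autInvariant`);
2. if `Γ` is transitive on the edges, `C̄` is constant on the edges, i.e. `C̄ = J + xA` for a real
   `x` (`exists_dual_ones_add_smul_adjMatrix`);
3. testing `ϑ I - (J + xA) ⪰ 0` on `𝟙` (`A𝟙 = k𝟙`) gives `ϑ ≥ n + xk`, and on an eigenvector `f`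
   of `A` with eigenvalue `-τ ≠ k` (so `𝟙ᵀf = 0`, `Jf = 0`) gives `ϑ ≥ -xτ`; the combination
   `(k+τ)ϑ = τϑ + kϑ ≥ τ(n + xk) - kxτ = nτ` is **`ϑ(G) ≥ nτ/(k+τ)`** (`ratioBound_le_lovaszTheta`),
   whence `ϑ(G) = nτ/(k+τ)` when moreover `A + τI ⪰ 0` (`lovaszTheta_eq_ratioBound`).

With Theorem 8 (`ϑ(G)ϑ(Ḡ) = n` for vertex-transitive `G`,
`lovaszTheta_mul_lovaszTheta_compl_eq_card`) this gives, for graphs that are both vertex- and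
edge-transitive, `ϑ(Ḡ) = (k+τ)/τ = 1 + k/τ` (`= 1 - λ₁/λ_n`; Knuth 1994, §26;
`lovaszTheta_compl_eq_of_transitive`) — the case in which Hoffman's bound `χ(G) ≥ 1 - λ₁/λ_n` is
attained by `ϑ(Ḡ)`.

Statements are eigenvalue-free, as in `HoffmanLovaszBound`: "`-τ` is the least eigenvalue of `A`"
is rendered as `A + τI ⪰ 0` together with an eigenvector `f ≠ 0`, `Af = -τ f`.

References: [Lovasz1979] L. Lovász, On the Shannon capacity of a graph, IEEE Trans. Inform.
Theory 25 (1979) 1–7, Theorem 9 and its proof (p. 5), Theorem 8 (p. 5); [Knuth1994] D. E. Knuth,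
The sandwich theorem, Electron. J. Combin. 1 (1994) A1, §25 (automorphisms; the Lemma and its
proof), §26.
-/

namespace Literature.Combinatorics.SimpleGraph.LovaszThetaEdgeTransitive

open Matrix Finset _root_.SimpleGraph
open Literature.Combinatorics.SimpleGraph

variable {V : Type*}

/-- A simple graph is **edge-transitive** ("its automorphism group is transitive on the edges",
Lovász 1979, Theorem 9; "edge-symmetric", Knuth 1994, §25: "given `u — v` and `u' — v'` there is
an automorphism `p` such that `p(u) = u'` and `p(v) = v'` or `p(u) = v'` and `p(v) = u'`").
[cite: Knuth1994, §25 (definition of edge-symmetric)] [cite: Lovasz1979, Theorem 9 (p. 5)] -/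
def IsEdgeTransitive (G : SimpleGraph V) : Prop :=
  ∀ ⦃a b c d : V⦄, G.Adj a b → G.Adj c d →
    ∃ φ : G ≃g G, (φ a = c ∧ φ b = d) ∨ (φ a = d ∧ φ b = c)

/-- A matrix invariant under an edge-transitive automorphism group and symmetric is constant on
the edges (Knuth 1994, §25: "since `G` is edge-symmetric, `Ā` has the form `J + xB`").
[cite: Knuth1994, §25 (proof of the Lemma)] -/
theorem IsEdgeTransitive.apply_eq_of_adj {G : SimpleGraph V} (hE : IsEdgeTransitive G)
    {A : Matrix V V ℝ} (hsymm : ∀ u v, A u v = A v u)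
    (hinv : ∀ (φ : G ≃g G) (u v : V), A (φ u) (φ v) = A u v) {a b c d : V} (hab : G.Adj a b)
    (hcd : G.Adj c d) : A a b = A c d := by
  obtain ⟨φ, h | h⟩ := hE hab hcd
  · rw [← hinv φ a b, h.1, h.2]
  · rw [← hinv φ a b, h.1, h.2, hsymm]

variable [Fintype V] [DecidableEq V]

/-! ### Symmetrisation of optimum dual feasible matrices -/

omit [Fintype V] [DecidableEq V] in
/-- Permuting rows and columns of a Knuth-feasible matrix by an automorphism gives a feasible
matrix ("if `A` is an optimum feasible matrix for `G`, so is `p(A)`", Knuth 1994, §25).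
[cite: Knuth1994, §25 (proof of the Lemma)] -/
theorem isThetaDualFeasible_submatrix {H : SimpleGraph V} {A : Matrix V V ℝ}
    (hA : IsThetaDualFeasible H A) (φ : H ≃g H) : IsThetaDualFeasible H (A.submatrix φ φ) where
  isHermitian := hA.isHermitian.submatrix φ
  apply_eq_one u v huv := by
    rw [submatrix_apply]
    exact hA.apply_eq_one fun h => huv (φ.map_adj_iff.1 h)

omit [Fintype V] [DecidableEq V] in
/-- `sI - P⁻¹AP = P⁻¹(sI - A)P ⪰ 0` whenever `sI - A ⪰ 0` (`p(A)` has the same `Λ`).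
[cite: Knuth1994, §25 (proof of the Lemma)] -/
theorem posSemidef_smul_one_sub_submatrix [Fintype V] [DecidableEq V] {A : Matrix V V ℝ} {s : ℝ}
    (hs : (s • (1 : Matrix V V ℝ) - A).PosSemidef) (e : V ≃ V) :
    (s • (1 : Matrix V V ℝ) - A.submatrix e e).PosSemidef := by
  have h : (s • (1 : Matrix V V ℝ) - A).submatrix e e =
      s • (1 : Matrix V V ℝ) - A.submatrix e e := by
    ext i j
    simp [Matrix.one_apply, e.apply_eq_iff_eq]
  rw [← h]
  exact hs.submatrix e

/-- **Lovász's symmetrisation on the dual side** (1979, proof of Theorem 9; Knuth 1994, §25):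
there is an optimum Knuth-feasible matrix — `C` feasible with `ϑ(H) I - C ⪰ 0` — which is
invariant under every automorphism of `H`: average any optimum `C` (`exists_dual_of_lovaszTheta_eq`)
over the finite automorphism group, `C̄ = |Γ|⁻¹ Σ_{P ∈ Γ} P⁻¹CP`.
[cite: Lovasz1979, proof of Theorem 9 (p. 5)] [cite: Knuth1994, §25 (proof of the Lemma)] -/
theorem exists_dual_autInvariant [Nonempty V] (H : SimpleGraph V) [DecidableRel H.Adj] :
    ∃ C : Matrix V V ℝ, IsThetaDualFeasible H C ∧
      (lovaszTheta H • (1 : Matrix V V ℝ) - C).PosSemidef ∧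
      ∀ (φ : H ≃g H) (u v : V), C (φ u) (φ v) = C u v := by
  haveI : Finite (H ≃g H) := Finite.of_injective _ RelIso.toEquiv_injective
  letI : Fintype (H ≃g H) := Fintype.ofFinite _
  obtain ⟨C₀, hC₀, hpsd₀⟩ := exists_dual_of_lovaszTheta_eq H
  set N : ℝ := (Fintype.card (H ≃g H) : ℝ) with hN
  have hN0 : N ≠ 0 := by rw [hN]; exact_mod_cast Fintype.card_ne_zero
  obtain ⟨C, hC⟩ : ∃ C : Matrix V V ℝ, C = N⁻¹ • ∑ φ : H ≃g H, C₀.submatrix φ φ := ⟨_, rfl⟩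
  have hCapply : ∀ u v, C u v = N⁻¹ * ∑ φ : H ≃g H, C₀ (φ u) (φ v) := fun u v => by
    simp [hC, Matrix.sum_apply]
  refine ⟨C, ⟨?_, fun u v huv => ?_⟩, ?_, fun ψ u v => ?_⟩
  · -- symmetric
    refine Matrix.IsHermitian.ext fun u v => ?_
    rw [star_trivial, hCapply, hCapply]
    exact congrArg _ (sum_congr rfl fun φ _ => hC₀.apply_comm _ _)
  · -- `= 1` off the edges, because automorphisms preserve non-adjacency
    rw [hCapply]
    have h1 : ∀ φ : H ≃g H, C₀ (φ u) (φ v) = 1 := fun φ =>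
      hC₀.apply_eq_one fun h => huv (φ.map_adj_iff.1 h)
    rw [sum_congr rfl fun φ _ => h1 φ, sum_const, card_univ, nsmul_eq_mul, mul_one,
      inv_mul_cancel₀ hN0]
  · -- `ϑ I - C̄ = |Γ|⁻¹ Σ_P (ϑ I - P⁻¹ C₀ P) ⪰ 0`
    have h : lovaszTheta H • (1 : Matrix V V ℝ) - C =
        N⁻¹ • ∑ φ : H ≃g H, (lovaszTheta H • (1 : Matrix V V ℝ) - C₀.submatrix φ φ) := by
      ext u v
      simp only [hC, Matrix.sub_apply, Matrix.smul_apply, Matrix.sum_apply, Matrix.one_apply,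
        submatrix_apply, smul_eq_mul]
      rw [sum_sub_distrib, sum_const, card_univ, nsmul_eq_mul, mul_sub, ← hN, ← mul_assoc,
        inv_mul_cancel₀ hN0, one_mul]
    rw [h]
    exact (posSemidef_sum univ fun φ _ => posSemidef_smul_one_sub_submatrix hpsd₀ φ.toEquiv).smul
      (inv_nonneg.2 (Nat.cast_nonneg _))
  · -- `Γ`-invariance (re-index `φ ↦ φψ`)
    rw [hCapply, hCapply]
    congr 1
    exact Fintype.sum_equiv (Equiv.mulRight ψ) _ _ fun φ => rfl

/-- For an **edge-transitive** graph the symmetrised optimum dual matrix is constant on the edges,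
hence of the form `J + xA` (`A` the adjacency matrix): there is a real `x` with
`ϑ(G) I - (J + xA) ⪰ 0` (Lovász 1979, proof of Theorem 9: "`C̄` is clearly of the form `J - xA`";
Knuth 1994, §25). [cite: Lovasz1979, proof of Theorem 9 (p. 5)]
[cite: Knuth1994, §25 (proof of the Lemma)] -/
theorem exists_dual_ones_add_smul_adjMatrix [Nonempty V] {G : SimpleGraph V} [DecidableRel G.Adj]
    (hE : IsEdgeTransitive G) :
    ∃ x : ℝ, (lovaszTheta G • (1 : Matrix V V ℝ) -
      ((of fun _ _ => (1 : ℝ)) + x • G.adjMatrix ℝ)).PosSemidef := by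
  obtain ⟨C, hC, hpsd, hinv⟩ := exists_dual_autInvariant G
  by_cases hedge : ∃ a b : V, G.Adj a b
  · obtain ⟨a, b, hab⟩ := hedge
    refine ⟨C a b - 1, ?_⟩
    have h : (of fun _ _ => (1 : ℝ)) + (C a b - 1) • G.adjMatrix ℝ = C := by
      ext u v
      by_cases huv : G.Adj u v
      · simp only [Matrix.add_apply, of_apply, Matrix.smul_apply, adjMatrix_apply, huv, if_true,
          smul_eq_mul, mul_one]
        rw [hE.apply_eq_of_adj hC.apply_comm hinv hab huv]
        ring
      · simp [huv, hC.apply_eq_one huv]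
    rw [h]
    exact hpsd
  · refine ⟨0, ?_⟩
    have h : (of fun _ _ => (1 : ℝ)) + (0 : ℝ) • G.adjMatrix ℝ = C := by
      ext u v
      have huv : ¬G.Adj u v := fun h => hedge ⟨u, v, h⟩
      simp [hC.apply_eq_one huv]
    rw [h]
    exact hpsd

/-! ### The lower bound `ϑ(G) ≥ nτ/(k+τ)` -/

omit [DecidableEq V] in
/-- The all-ones matrix `J` has quadratic form `yᵀJy = (Σ_u y_u)²`. [folklore] -/
@[folklore] private theorem dotProduct_ones_mulVec (y : V → ℝ) :
    y ⬝ᵥ (of fun _ _ => (1 : ℝ) : Matrix V V ℝ) *ᵥ y = (∑ u, y u) ^ 2 := by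
  rw [dotProduct_mulVec_eq_sum_mul, sq, sum_mul_sum]
  simp

omit [DecidableEq V] in
/-- In a `k`-regular graph an adjacency eigenvector `f` with eigenvalue `μ ≠ k` has `Σ_u f_u = 0`
(`𝟙` is a `k`-eigenvector of the symmetric `A`: `k Σf = 𝟙ᵀAf = μ Σf`). [folklore] -/
@[folklore] private theorem sum_eq_zero_of_eigenvector {G : SimpleGraph V} [DecidableRel G.Adj]
    {k : ℕ} (hreg : G.IsRegularOfDegree k) {μ : ℝ} (hμ : μ ≠ k) {f : V → ℝ}
    (hAf : G.adjMatrix ℝ *ᵥ f = μ • f) : ∑ u, f u = 0 := by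
  have hA1 : (G.adjMatrix ℝ *ᵥ fun _ => (1 : ℝ)) = fun _ => (k : ℝ) := by
    funext v
    have h := adjMatrix_mulVec_const_apply_of_regular (α := ℝ) (a := (1 : ℝ)) hreg (v := v)
    rw [mul_one] at h
    exact h
  have hsum : (fun _ => (1 : ℝ)) ⬝ᵥ f = ∑ u, f u := by simp [dotProduct]
  have h1 : (fun _ => (1 : ℝ)) ⬝ᵥ (G.adjMatrix ℝ *ᵥ f) = (k : ℝ) * ∑ u, f u := by
    rw [dotProduct_mulVec, ← mulVec_transpose, transpose_adjMatrix, hA1]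
    simp [dotProduct, mul_sum]
  have h2 : (fun _ => (1 : ℝ)) ⬝ᵥ (G.adjMatrix ℝ *ᵥ f) = μ * ∑ u, f u := by
    rw [hAf, dotProduct_smul, hsum, smul_eq_mul]
  have h3 : ((k : ℝ) - μ) * ∑ u, f u = 0 := by rw [sub_mul, ← h1, ← h2, sub_self]
  exact (mul_eq_zero.1 h3).resolve_left (sub_ne_zero.2 (Ne.symm hμ))

/-- **Lovász 1979, Theorem 9 (equality case), lower bound:** for a `k`-regular edge-transitive
graph `G` on `n` vertices and an adjacency eigenvector `f ≠ 0`, `Af = -τf` with `τ > 0`,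
`nτ/(k+τ) ≤ ϑ(G)`.  Proof (Lovász p. 5; Knuth §25): test `ϑI - (J + xA) ⪰ 0`
(`exists_dual_ones_add_smul_adjMatrix`) on `𝟙` and on `f`: `ϑ ≥ n + xk` and `ϑ ≥ -xτ`, so
`(k+τ)ϑ ≥ τ(n + xk) - kxτ = nτ`. [cite: Lovasz1979, Theorem 9 (p. 5), equality assertion and its
proof] [cite: Knuth1994, §25 (Lemma)] -/
theorem ratioBound_le_lovaszTheta [Nonempty V] {G : SimpleGraph V} [DecidableRel G.Adj] {k : ℕ}
    {τ : ℝ} (hreg : G.IsRegularOfDegree k) (hE : IsEdgeTransitive G) (hτ : 0 < τ) {f : V → ℝ}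
    (hf : f ≠ 0) (hAf : G.adjMatrix ℝ *ᵥ f = (-τ) • f) :
    Fintype.card V * τ / (k + τ) ≤ lovaszTheta G := by
  obtain ⟨x, hpsd⟩ := exists_dual_ones_add_smul_adjMatrix hE
  set θ := lovaszTheta G with hθ
  set n : ℝ := (Fintype.card V : ℝ) with hn
  have hkτ : 0 < (k : ℝ) + τ := by positivity
  have hn0 : 0 < n := by rw [hn]; exact_mod_cast Fintype.card_pos
  -- the quadratic form of `ϑI - (J + xA)`
  have hq : ∀ y : V → ℝ,
      0 ≤ θ * (y ⬝ᵥ y) - (∑ u, y u) ^ 2 - x * (y ⬝ᵥ G.adjMatrix ℝ *ᵥ y) := by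
    intro y
    have h := hpsd.dotProduct_mulVec_nonneg y
    rw [star_trivial, sub_mulVec, add_mulVec, smul_mulVec, smul_mulVec, one_mulVec,
      dotProduct_sub, dotProduct_add, dotProduct_smul, dotProduct_smul, dotProduct_ones_mulVec,
      smul_eq_mul, smul_eq_mul] at h
    linarith
  -- test vector `𝟙`: `ϑ ≥ n + xk`
  have hA1 : (G.adjMatrix ℝ *ᵥ fun _ => (1 : ℝ)) = fun _ => (k : ℝ) := by
    funext v
    have h := adjMatrix_mulVec_const_apply_of_regular (α := ℝ) (a := (1 : ℝ)) hreg (v := v)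
    rw [mul_one] at h
    exact h
  have hone : n + x * k ≤ θ := by
    have h := hq fun _ => 1
    rw [hA1] at h
    simp only [dotProduct, mul_one, one_mul, sum_const, card_univ, nsmul_eq_mul] at h
    rw [← hn] at h
    -- `h : 0 ≤ θ * n - n ^ 2 - x * (n * k)`
    have h' : 0 ≤ n * (θ - n - x * k) := by nlinarith [h]
    nlinarith [(mul_nonneg_iff_of_pos_left hn0).1 h']
  -- test vector `f`: `ϑ ≥ -xτ`
  have hfsum : ∑ u, f u = 0 :=
    sum_eq_zero_of_eigenvector hreg (μ := -τ) (by have : (0 : ℝ) ≤ k := Nat.cast_nonneg _; linarith) hAf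
  have hff : 0 < f ⬝ᵥ f := by
    obtain ⟨u, hu⟩ : ∃ u, f u ≠ 0 := by
      by_contra h
      exact hf (funext fun u => by simpa using not_exists.1 h u)
    exact lt_of_lt_of_le (mul_self_pos.2 hu) (Finset.single_le_sum (f := fun v => f v * f v)
      (fun v _ => mul_self_nonneg (f v)) (mem_univ u))
  have htwo : -x * τ ≤ θ := by
    have h := hq f
    rw [hfsum, hAf, dotProduct_smul, smul_eq_mul] at h
    -- `h : 0 ≤ θ * (f ⬝ᵥ f) - 0 ^ 2 - x * (-τ * (f ⬝ᵥ f))`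
    have h' : 0 ≤ (f ⬝ᵥ f) * (θ + x * τ) := by nlinarith [h]
    nlinarith [(mul_nonneg_iff_of_pos_left hff).1 h']
  -- combine: `(k+τ)ϑ = τϑ + kϑ ≥ τ(n + xk) - kxτ = nτ`
  rw [div_le_iff₀ hkτ]
  have hk0 : (0 : ℝ) ≤ k := Nat.cast_nonneg _
  nlinarith [mul_le_mul_of_nonneg_left hone hτ.le, mul_le_mul_of_nonneg_left htwo hk0]

/-- **Lovász 1979, Theorem 9 (equality case):** for a `k`-regular edge-transitive graph on `n`
vertices whose least adjacency eigenvalue is `-τ < 0` — rendered as `A + τI ⪰ 0` together with an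
eigenvector `f ≠ 0`, `Af = -τf` — `ϑ(G) = nτ/(k+τ)` (`= -nλ_n/(λ₁ - λ_n)`).  The inequality `≤`
is `HoffmanLovaszBound.lovaszTheta_le_ratioBound`. [cite: Lovasz1979, Theorem 9 (p. 5)]
[cite: Knuth1994, §25 (Lemma: "If `G` is edge-symmetric and regular, equality holds in Lemma 24")] -/
theorem lovaszTheta_eq_ratioBound [Nonempty V] {G : SimpleGraph V} [DecidableRel G.Adj] {k : ℕ}
    {τ : ℝ} (hreg : G.IsRegularOfDegree k) (hE : IsEdgeTransitive G) (hτ : 0 < τ)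
    (hpsd : (G.adjMatrix ℝ + τ • (1 : Matrix V V ℝ)).PosSemidef) {f : V → ℝ} (hf : f ≠ 0)
    (hAf : G.adjMatrix ℝ *ᵥ f = (-τ) • f) :
    lovaszTheta G = Fintype.card V * τ / (k + τ) :=
  le_antisymm (HoffmanLovaszBound.lovaszTheta_le_ratioBound hreg hτ hpsd)
    (ratioBound_le_lovaszTheta hreg hE hτ hf hAf)

/-- **Vertex- and edge-transitive graphs** (Lovász 1979, Theorems 8 and 9; Knuth 1994, §26): if
`G` is moreover vertex-transitive then `ϑ(G)ϑ(Ḡ) = n` (`lovaszTheta_mul_lovaszTheta_compl_eq_card`),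
so `ϑ(Ḡ) = (k+τ)/τ = 1 + k/τ` (`= 1 - λ₁/λ_n`: Hoffman's bound `χ(G) ≥ 1 - λ₁/λ_n` is attained
by `ϑ(Ḡ)` on such graphs). [cite: Lovasz1979, Theorem 8 and Theorem 9 (p. 5)]
[cite: Knuth1994, §26 (proof of the Corollary: Lemma 25 and Theorem 25)] -/
theorem lovaszTheta_compl_eq_of_transitive [Nonempty V] {G : SimpleGraph V} [DecidableRel G.Adj]
    {k : ℕ} {τ : ℝ} (hV : IsVertexTransitive G) (hE : IsEdgeTransitive G)
    (hreg : G.IsRegularOfDegree k) (hτ : 0 < τ)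
    (hpsd : (G.adjMatrix ℝ + τ • (1 : Matrix V V ℝ)).PosSemidef) {f : V → ℝ} (hf : f ≠ 0)
    (hAf : G.adjMatrix ℝ *ᵥ f = (-τ) • f) :
    lovaszTheta Gᶜ = 1 + k / τ := by
  have hprod := lovaszTheta_mul_lovaszTheta_compl_eq_card hV
  rw [lovaszTheta_eq_ratioBound hreg hE hτ hpsd hf hAf] at hprod
  have hn0 : (0 : ℝ) < Fintype.card V := by exact_mod_cast Fintype.card_pos
  have hkτ : 0 < (k : ℝ) + τ := by positivity
  have hτ0 : τ ≠ 0 := hτ.ne'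
  -- `(nτ/(k+τ)) ϑ(Ḡ) = n` ⇒ `ϑ(Ḡ) = (k+τ)/τ`
  have h : lovaszTheta Gᶜ = (k + τ) / τ := by
    field_simp at hprod
    field_simp
    nlinarith [hprod]
  rw [h]
  field_simp
  ring

/-! ### Examples: `K_n` -/

omit [Fintype V] in
/-- The complete graph is edge-transitive: every permutation is an automorphism of `K_n`, and a
product of two transpositions maps an ordered edge `(a, b)` to any other `(c, d)` (Knuth 1994, §27:
the graphs `P(m,t,q)` — `K_m = P(m,1,0)` — are vertex- and edge-symmetric "because every
permutation of `S` induces an automorphism"). [cite: Knuth1994, §27 (symmetry of the graphs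
`P(m,t,q)`; `P(m,1,0) = K_m`)] -/
theorem isEdgeTransitive_top : IsEdgeTransitive (⊤ : SimpleGraph V) := by
  intro a b c d hab hcd
  rw [top_adj] at hab hcd
  set σ₁ : V ≃ V := Equiv.swap a c with hσ₁
  have hb : σ₁ b ≠ c := by
    rw [Ne, hσ₁, Equiv.swap_apply_eq_iff, Equiv.swap_apply_right]
    exact fun h => hab h.symm
  set σ : V ≃ V := σ₁.trans (Equiv.swap (σ₁ b) d) with hσ
  refine ⟨⟨σ, ?_⟩, Or.inl ⟨?_, ?_⟩⟩
  · intro x y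
    simp [σ.injective.ne_iff]
  · show σ a = c
    rw [hσ, Equiv.trans_apply]
    have ha : σ₁ a = c := by rw [hσ₁, Equiv.swap_apply_left]
    rw [ha]
    exact Equiv.swap_apply_of_ne_of_ne hb.symm hcd
  · show σ b = d
    rw [hσ, Equiv.trans_apply, Equiv.swap_apply_left]

/-- The edgeless graph is (vacuously) edge-transitive. -/
example : IsEdgeTransitive (⊥ : SimpleGraph V) := fun _ _ _ _ hab _ => absurd hab (by simp)

/-- Sanity check of the hypotheses on `K_n`, `n ≥ 2`: `(n-1)`-regular (`IsRegularOfDegree.top`),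
edge-transitive (`isEdgeTransitive_top`), `A + I = J ⪰ 0`, and `f = e_a - e_b` satisfies
`Af = -f`; `lovaszTheta_eq_ratioBound` returns `ϑ(K_n) = n·1/((n-1)+1) = 1` — the tree's
`HoffmanLovaszBound.lovaszTheta_completeGraph`, recovered. -/
example [Nontrivial V] : lovaszTheta (⊤ : SimpleGraph V) = 1 := by
  obtain ⟨a, b, hab⟩ := exists_pair_ne V
  haveI : Nonempty V := ⟨a⟩
  have hreg : (⊤ : SimpleGraph V).IsRegularOfDegree (Fintype.card V - 1) := IsRegularOfDegree.top
  have hJ : (⊤ : SimpleGraph V).adjMatrix ℝ + (1 : ℝ) • (1 : Matrix V V ℝ) =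
      of fun _ _ => (1 : ℝ) := by
    ext u v
    by_cases h : u = v <;> simp [h]
  have hpsd : ((⊤ : SimpleGraph V).adjMatrix ℝ + (1 : ℝ) • (1 : Matrix V V ℝ)).PosSemidef := by
    rw [hJ]
    refine PosSemidef.of_dotProduct_mulVec_nonneg (Matrix.IsHermitian.ext fun u v => by simp)
      fun x => ?_
    rw [star_trivial, dotProduct_ones_mulVec]
    positivity
  -- the eigenvector `f = e_a - e_b`: `Σ f = 0`, so `Af = (J - I)f = -f`
  set f : V → ℝ := Pi.single a 1 - Pi.single b 1 with hf
  have hf0 : f ≠ 0 := fun h => by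
    have h1 := congrFun h a
    rw [hf, Pi.sub_apply, Pi.single_eq_same, Pi.single_eq_of_ne hab, sub_zero] at h1
    exact one_ne_zero h1
  have hsum : ∑ v, f v = 0 := by
    simp [hf, sum_sub_distrib, Finset.sum_pi_single']
  have hA : (⊤ : SimpleGraph V).adjMatrix ℝ = (of fun _ _ => (1 : ℝ)) - (1 : Matrix V V ℝ) := by
    rw [← hJ, one_smul, add_sub_cancel_right]
  have hAf : (⊤ : SimpleGraph V).adjMatrix ℝ *ᵥ f = (-1 : ℝ) • f := by
    have hJf : (of fun _ _ => (1 : ℝ) : Matrix V V ℝ) *ᵥ f = 0 := by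
      funext v
      simp only [mulVec, dotProduct, of_apply, one_mul, Pi.zero_apply]
      exact hsum
    rw [hA, sub_mulVec, one_mulVec, hJf, zero_sub, neg_one_smul]
  have h := lovaszTheta_eq_ratioBound hreg isEdgeTransitive_top one_pos hpsd hf0 hAf
  have hpos : 0 < Fintype.card V := Fintype.card_pos
  have hn1 : ((Fintype.card V - 1 : ℕ) : ℝ) + 1 = Fintype.card V := by
    rw [Nat.cast_sub hpos, Nat.cast_one]; ring
  rw [h, hn1, mul_one, div_self (by exact_mod_cast hpos.ne')]

end Literature.Combinatorics.SimpleGraph.LovaszThetaEdgeTransitive
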